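import Summits.PneNP.PneNP.Theorems.ExpanderLinearGeneratorsResolutionNFreeColumnLLLMaster
import Summits.PneNP.PneNP.Theorems.ExpanderLinearGeneratorsResolutionNFreeColumnLaw
import HarnessLib

/-!
# The n-free resolution-size rung for expanding linear systems, XVII: Theorem C′ — the exponential law up to column weight `r^{(1-ε)(⌈3ℓ/4⌉-1)}`

Support file for crux `stmt-PneNP-11442`
(`Summit.PneNP.PneNP.Theses.ExpanderLinearGenerators.ExpansionForcesDepthFregeSize`, the
EXPANSION-SCALE LAW: proofs of the XOR-CNF of an unsolvable `ℓ`-sparse `(r, 3ℓ/4)`-boundary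
expander have size `≥ 2^{r^ε}`, uniformly in the numbers `n` of variables and `m` of rows).
Theorem C (file XII, `resolution_size_nfree_column`) is the n-free, m-free EXPONENTIAL
resolution-size law for systems of column weight `Δ ≤ r^{(1-ε)ℓ/2 - 1}/2^ℓ`, proved by an
altered restriction and a union bound. With the Lovász Local Lemma in place of the union bound
(file XVI, `one_lt_length_mul_lll`) the admissible column weight rises to the natural threshold
of the load-bounded restriction method, the full load `L = ⌈3ℓ/4⌉ - 1`:

* `resolution_size_nfree_column_lll` (THEOREM C′): for `ℓ ≥ 1`, `0 < ε < 1`, real `r ≥ 2`,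
  any `n, m`, every `ℓ`-sparse `E : Fin m → LinEqMod 2 n` whose supports form an
  `(r, 3ℓ/4)`-boundary expander and whose variables each lie in at most
  `Δ ≤ r^{(1-ε)(⌈3ℓ/4⌉-1)}/((ℓ+1) 2^{ℓ+4})` rows, every resolution refutation of
  `sumEncoding 1 E` has at least `2^{r^ε/112 - 2}` lines;
* `resolution_size_column_pow_lll`: the crux-shaped corollary — for every column-weight exponent
  `0 ≤ a < ⌈3ℓ/4⌉ - 1` there are `ε > 0`, `R` with `|π| ≥ 2^{r^ε}` for `r ≥ R` at column weight
  `≤ r^a` (Theorem C: `a < ℓ/2 - 1`).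

For `ℓ = 9` (the smallest locality of the open core of the crux) the exponent rises from `3.5`
to `6`; in Krajíček's regime `m = n²`, `r = n^{1-δ}` (crux `stmt-PneNP-11443`) the column weight
is `≤ n²`, so the n-free exponential resolution law now covers every `δ < 1 - 2/(⌈3ℓ/4⌉-1)`
(all `δ < 2/3` at `ℓ = 9`; Ben-Sasson–Wigderson's n-dependent law stops at `δ < 1/2`).
`one_le_of_colWeight` disposes of the degenerate bound `Δ = 0`.

References: P. Erdős, L. Lovász (1975); N. Alon, J. Spencer, *The Probabilistic Method*, Ch. 5;
E. Ben-Sasson, A. Wigderson, J. ACM 48 (2001), Thm. 6.5; P. Beame, T. Pitassi, FOCS 1996;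
J. Krajíček, *Proof complexity* (CUP 2019), §13.4 (Lemma 13.4.5, Cor. 13.4.6), Problem 19.4.5.
-/

namespace Summit.PneNP.PneNP.Theorems.ResNFree

set_option linter.dupNamespace false -- `Summit.PneNP.PneNP.…`: summit = sub-problem (D-0017)

open Finset Filter Topology Literature.Computability.Complexity Literature.Computability.MetaComplexity
open Summit.PneNP.PneNP.Theorems.ResKRestriction
open Literature.Barriers.ValiantsHypothesis (two_rpow_le_exp)

variable {m n : ℕ}

/-- **A nonempty expanding system has positive column weight somewhere.** If the row supports
form an `(r, c)`-boundary expander with `c > 0`, `r ≥ 1`, and `k` is a row, then some variable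
lies in a row; so any bound `Δ` on the column weights is `≥ 1`. [folklore] -/
theorem one_le_of_colWeight (E : Fin m → LinEqMod 2 n) {r c : ℝ}
    (hexp : IsBoundaryExpander (rowVars E) r c) (hc : 0 < c) (hr : 1 ≤ r) (k : Fin m) {Δ : ℕ}
    (hcol : ∀ j : Fin n, ((univ : Finset (Fin m)).filter fun i => j ∈ (E i).supp).card ≤ Δ) :
    1 ≤ Δ := by
  classical
  have h := hexp {k} (by rw [card_singleton, Nat.cast_one]; exact hr)
  rw [card_singleton, Nat.cast_one, mul_one] at h
  have hpos : (0 : ℝ) < (boundary (rowVars E) {k}).card := hc.trans_le h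
  have hpos' : 0 < (boundary (rowVars E) {k}).card := by exact_mod_cast hpos
  obtain ⟨v, hv⟩ := Finset.card_pos.1 hpos'
  have hv' := boundary_subset_cover _ hv
  rw [mem_cover] at hv'
  obtain ⟨i, hi, hvi⟩ := hv'
  rw [mem_singleton] at hi
  subst hi
  obtain ⟨j, hj, rfl⟩ := mem_rowVars.1 hvi
  have h1 : 1 ≤ ((univ : Finset (Fin m)).filter fun i' => j ∈ (E i').supp).card :=
    Finset.card_pos.2 ⟨i, mem_filter.2 ⟨mem_univ _, hj⟩⟩
  exact h1.trans (hcol j)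

/-- The killing estimate of the local-lemma method: with sampling rate `1/(K+1)`,
`K + 1 ≤ r^{1-ε} + 1`, and `q ≥ r/16`, `((4K+2)/(4K+3))^q ≤ exp(-r^ε/112)`. [folklore] -/
theorem ratio_pow_le_exp_neg_lll {K q : ℕ} {r ε : ℝ} (hr : 1 ≤ r) (hε : ε ≤ 1)
    (hK : (K : ℝ) + 1 ≤ r ^ (1 - ε) + 1) (hq : r / 16 ≤ (q : ℝ)) :
    ((4 * (K : ℝ) + 2) / (4 * K + 3)) ^ q ≤ Real.exp (-(r ^ ε) / 112) := by
  have hr0 : 0 < r := by linarith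
  have hK0 : (0 : ℝ) < 4 * (K : ℝ) + 3 := by positivity
  have hbase : (4 * (K : ℝ) + 2) / (4 * K + 3) = -(1 / (4 * K + 3)) + 1 := by
    field_simp; ring
  have hbase_le : (4 * (K : ℝ) + 2) / (4 * K + 3) ≤ Real.exp (-(1 / (4 * K + 3))) := by
    rw [hbase]; exact Real.add_one_le_exp _
  have hbase0 : (0 : ℝ) ≤ (4 * (K : ℝ) + 2) / (4 * K + 3) := by positivity
  have hstep1 : ((4 * (K : ℝ) + 2) / (4 * K + 3)) ^ q
      ≤ Real.exp (-(1 / (4 * K + 3))) ^ q := pow_le_pow_left₀ hbase0 hbase_le _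
  have hstep2 : Real.exp (-(1 / (4 * (K : ℝ) + 3))) ^ q
      = Real.exp ((q : ℝ) * -(1 / (4 * K + 3))) := by
    rw [Real.exp_nat_mul]
  have hstep3 : Real.exp ((q : ℝ) * -(1 / (4 * (K : ℝ) + 3))) ≤ Real.exp (-(r ^ ε) / 112) := by
    rw [Real.exp_le_exp]
    have h1e : (1 : ℝ) ≤ r ^ (1 - ε) := Real.one_le_rpow hr (by linarith)
    have h4K : 4 * (K : ℝ) + 3 ≤ 7 * r ^ (1 - ε) := by linarith
    have hprod : r ^ ε * r ^ (1 - ε) = r := by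
      rw [← Real.rpow_add hr0]; norm_num
    have hrε : 0 ≤ r ^ ε := (Real.rpow_pos_of_pos hr0 _).le
    have hq' : r ^ ε / 112 ≤ (q : ℝ) / (4 * K + 3) := by
      rw [div_le_div_iff₀ (by norm_num) hK0]
      calc r ^ ε * (4 * (K : ℝ) + 3) ≤ r ^ ε * (7 * r ^ (1 - ε)) :=
            mul_le_mul_of_nonneg_left h4K hrε
        _ = 7 * r := by rw [mul_left_comm, hprod]
        _ ≤ (q : ℝ) * 112 := by linarith
    have : (q : ℝ) * -(1 / (4 * (K : ℝ) + 3)) = -((q : ℝ) / (4 * K + 3)) := by ring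
    rw [this, neg_div]
    exact neg_le_neg hq'
  calc ((4 * (K : ℝ) + 2) / (4 * K + 3)) ^ q
      ≤ Real.exp (-(1 / (4 * K + 3))) ^ q := hstep1
    _ = Real.exp ((q : ℝ) * -(1 / (4 * K + 3))) := hstep2
    _ ≤ Real.exp (-(r ^ ε) / 112) := hstep3

/-- **The n-free EXPONENTIAL resolution-size law up to column weight
`r^{(1-ε)(⌈3ℓ/4⌉-1)}` (Theorem C′).** For every locality `ℓ ≥ 1` and `0 < ε < 1`, all real
`r ≥ 2`, all `n, m, Δ`, every `ℓ`-sparse system `E : Fin m → LinEqMod 2 n` whose supports form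
an `(r, 3ℓ/4)`-boundary expander and whose variables each lie in at most
`Δ ≤ r^{(1-ε)(⌈3ℓ/4⌉-1)}/((ℓ+1) 2^{ℓ+4})` rows, every resolution refutation of `sumEncoding 1 E`
has at least `2^{r^ε/112 - 2}` lines — independently of `n` and `m`. Proof: the local-lemma
master inequality (`one_lt_length_mul_lll`) with `L = ⌈3ℓ/4⌉ - 1`, `W = ⌈(3ℓ/4 - L) r/2⌉ - 1`,
`K + 1 = ⌈r^{1-ε}⌉`, and `((4K+2)/(4K+3))^{W/2+1} ≤ exp(-r^ε/112)`.
[Erdős–Lovász 1975; Alon–Spencer, Lemma 5.1.1; Ben-Sasson–Wigderson 2001, Thm. 6.5;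
Beame–Pitassi 1996; Krajíček 2019, §13.4] [folklore] -/
theorem resolution_size_nfree_column_lll (ℓ : ℕ) (hℓ : 1 ≤ ℓ) (ε : ℝ) (hε : 0 < ε) (hε1 : ε < 1)
    (r : ℝ) (hr : 2 ≤ r) (n m Δ : ℕ) (E : Fin m → LinEqMod 2 n)
    (hsparse : ∀ i, (E i).supp.card ≤ ℓ)
    (hexp : IsBoundaryExpander (fun i => (E i).supp.map Fin.valEmbedding) r (3 / 4 * ℓ))
    (hcol : ∀ j : Fin n, ((univ : Finset (Fin m)).filter fun i => j ∈ (E i).supp).card ≤ Δ)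
    (hΔ : (Δ : ℝ) ≤ r ^ ((1 - ε) * ((⌈(3 : ℝ) / 4 * ℓ⌉₊ - 1 : ℕ) : ℝ))
      / (((ℓ : ℝ) + 1) * 2 ^ (ℓ + 4)))
    (π : List (ResLine ℕ)) (hπ : IsResRefutation (sumEncoding 1 E) π) :
    (2 : ℝ) ^ (r ^ ε / 112 - 2) ≤ (π.length : ℝ) := by
  -- the constants `c = 3ℓ/4`, `T = ⌈c⌉`, `L = T - 1`
  set c : ℝ := 3 / 4 * ℓ with hc
  have hℓ' : (1 : ℝ) ≤ ℓ := by exact_mod_cast hℓ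
  have hcpos : 0 < c := by rw [hc]; positivity
  set T : ℕ := ⌈c⌉₊ with hT
  have hT1 : 1 ≤ T := Nat.one_le_iff_ne_zero.2 (Nat.ceil_pos.2 hcpos).ne'
  set L : ℕ := T - 1 with hL
  have hLT : L + 1 = T := Nat.sub_add_cancel hT1
  have hLreal : (L : ℝ) = T - 1 := by
    have : ((L + 1 : ℕ) : ℝ) = T := by exact_mod_cast hLT
    push_cast at this
    linarith
  have hTc : c ≤ T := Nat.le_ceil c
  have hLc : (L : ℝ) < c := by
    have h1 : (T : ℝ) < c + 1 := Nat.ceil_lt_add_one hcpos.le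
    linarith
  -- `c - L ≥ 1/4`: `4 (c - L) = 3ℓ - 4T + 4` is a positive integer
  have hcL4 : (1 : ℝ) / 4 ≤ c - L := by
    have hz : (0 : ℝ) < ((3 * (ℓ : ℤ) - 4 * (T : ℤ) + 4 : ℤ) : ℝ) := by
      push_cast
      rw [hc] at hLc
      linarith
    have hz' : (0 : ℤ) < 3 * (ℓ : ℤ) - 4 * (T : ℤ) + 4 := by exact_mod_cast hz
    have hz1 : (1 : ℤ) ≤ 3 * (ℓ : ℤ) - 4 * (T : ℤ) + 4 := hz'
    have hz1' : ((1 : ℤ) : ℝ) ≤ ((3 * (ℓ : ℤ) - 4 * (T : ℤ) + 4 : ℤ) : ℝ) := by exact_mod_cast hz1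
    push_cast at hz1'
    rw [hc, hLreal]
    linarith
  have hr0 : 0 < r := by linarith
  have hr1 : 1 ≤ r := by linarith
  -- the width threshold `W` and `W/2 + 1 ≥ r/16`
  set x : ℝ := (c - L) * r / 2 with hx
  have hxge : r / 8 ≤ x := by rw [hx]; nlinarith
  have hxpos : 0 < x := by linarith
  set W : ℕ := ⌈x⌉₊ - 1 with hWdef
  have hW1 : 1 ≤ ⌈x⌉₊ := Nat.one_le_iff_ne_zero.2 (Nat.ceil_pos.2 hxpos).ne'
  have hWreal : (W : ℝ) = ⌈x⌉₊ - 1 := by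
    have : ((W + 1 : ℕ) : ℝ) = ⌈x⌉₊ := by rw [hWdef]; exact_mod_cast Nat.sub_add_cancel hW1
    push_cast at this
    linarith
  have hWx : (W : ℝ) < x := by
    have h1 : (⌈x⌉₊ : ℝ) < x + 1 := Nat.ceil_lt_add_one hxpos.le
    linarith
  have hWge : x - 1 ≤ W := by
    have h1 : x ≤ (⌈x⌉₊ : ℝ) := Nat.le_ceil x
    linarith
  have hq : r / 16 ≤ ((W / 2 + 1 : ℕ) : ℝ) := by
    have hdm := Nat.div_add_mod W 2
    have hmod : W % 2 ≤ 1 := Nat.lt_succ_iff.1 (Nat.mod_lt _ (by norm_num))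
    have h1 : ((2 * (W / 2) + W % 2 : ℕ) : ℝ) = W := by exact_mod_cast hdm
    have h2 : ((W % 2 : ℕ) : ℝ) ≤ 1 := by exact_mod_cast hmod
    push_cast at h1 ⊢
    linarith
  -- the sampling rate `1/(K+1)`, `K + 1 = ⌈r^{1-ε}⌉`
  set K : ℕ := ⌈r ^ (1 - ε)⌉₊ - 1 with hKdef
  have hrpow : 0 < r ^ (1 - ε) := Real.rpow_pos_of_pos hr0 _
  have hK1 : 1 ≤ ⌈r ^ (1 - ε)⌉₊ := Nat.one_le_iff_ne_zero.2 (Nat.ceil_pos.2 hrpow).ne'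
  have hKeq : (K : ℝ) + 1 = ⌈r ^ (1 - ε)⌉₊ := by
    have : ((K + 1 : ℕ) : ℝ) = ⌈r ^ (1 - ε)⌉₊ := by
      rw [hKdef]; exact_mod_cast Nat.sub_add_cancel hK1
    push_cast at this
    exact this
  have hKge : r ^ (1 - ε) ≤ (K : ℝ) + 1 := by rw [hKeq]; exact Nat.le_ceil _
  have hKle : (K : ℝ) + 1 ≤ r ^ (1 - ε) + 1 := by
    rw [hKeq]; exact (Nat.ceil_lt_add_one hrpow.le).le
  -- `Δ ≥ 1` (a refutation has a row, and rows of an expander are nonempty)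
  have hm : 0 < m := pos_of_isResRefutation E hπ
  have hΔ1 : 1 ≤ Δ := one_le_of_colWeight E hexp hcpos hr1 ⟨0, hm⟩ hcol
  -- the column-weight condition of the master inequality
  have hKL : 16 * ((ℓ : ℝ) + 1) * Δ * 2 ^ ℓ ≤ ((K : ℝ) + 1) ^ L := by
    have hexpo : ((⌈(3 : ℝ) / 4 * ℓ⌉₊ - 1 : ℕ) : ℝ) = L := by rw [hL, hT, hc]
    rw [hexpo] at hΔ
    have h1 : r ^ ((1 - ε) * L) ≤ ((K : ℝ) + 1) ^ L := by
      rw [Real.rpow_mul hr0.le, Real.rpow_natCast]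
      exact pow_le_pow_left₀ hrpow.le hKge L
    have h2 : (Δ : ℝ) * (((ℓ : ℝ) + 1) * 2 ^ (ℓ + 4)) ≤ r ^ ((1 - ε) * L) := by
      rw [le_div_iff₀ (by positivity)] at hΔ; exact hΔ
    have h3 : (16 : ℝ) * ((ℓ : ℝ) + 1) * Δ * 2 ^ ℓ = (Δ : ℝ) * (((ℓ : ℝ) + 1) * 2 ^ (ℓ + 4)) := by
      rw [pow_add]; ring
    rw [h3]
    exact h2.trans h1
  -- the master inequality and the killing estimate
  have hM := one_lt_length_mul_lll E hexp hr K hsparse hcol hΔ1 hLc (by rw [← hx]; exact hWx)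
    hKL hπ
  have hratio := ratio_pow_le_exp_neg_lll (K := K) (q := W / 2 + 1) hr1 hε1.le hKle hq
  have hlen : 1 < 4 * (π.length : ℝ) * Real.exp (-(r ^ ε) / 112) :=
    lt_of_lt_of_le hM (mul_le_mul_of_nonneg_left hratio (by positivity))
  -- `2^{r^ε/112 - 2} = 2^{r^ε/112}/4 ≤ exp(r^ε/112)/4 < |π|`
  have hrε : 0 ≤ r ^ ε / 112 := by positivity
  have h2e : (2 : ℝ) ^ (r ^ ε / 112) ≤ Real.exp (r ^ ε / 112) := two_rpow_le_exp hrε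
  have hgoal : (2 : ℝ) ^ (r ^ ε / 112 - 2) = (2 : ℝ) ^ (r ^ ε / 112) / 4 := by
    rw [Real.rpow_sub (by norm_num : (0 : ℝ) < 2)]
    norm_num
  have hexp_inv : Real.exp (r ^ ε / 112) * Real.exp (-(r ^ ε) / 112) = 1 := by
    rw [← Real.exp_add, show r ^ ε / 112 + -(r ^ ε) / 112 = 0 by ring, Real.exp_zero]
  rw [hgoal]
  have hlen' : Real.exp (r ^ ε / 112) < 4 * (π.length : ℝ) := by
    have h := mul_lt_mul_of_pos_left hlen (Real.exp_pos (r ^ ε / 112))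
    rw [mul_one] at h
    calc Real.exp (r ^ ε / 112)
        < Real.exp (r ^ ε / 112) * (4 * (π.length : ℝ) * Real.exp (-(r ^ ε) / 112)) := h
      _ = 4 * (π.length : ℝ) * (Real.exp (r ^ ε / 112) * Real.exp (-(r ^ ε) / 112)) := by ring
      _ = 4 * (π.length : ℝ) := by rw [hexp_inv, mul_one]
  linarith

/-- **The n-free exponential resolution law at polynomial column weight, local-lemma form
(crux-shaped).** For every locality `ℓ ≥ 1` and every column-weight exponent
`0 ≤ a < ⌈3ℓ/4⌉ - 1` there are `ε > 0` and `R` such that for all `r ≥ R`, all `n, m`, every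
`ℓ`-sparse `E : Fin m → LinEqMod 2 n` whose supports form an `(r, 3ℓ/4)`-boundary expander and
each of whose variables lies in at most `r^a` rows, every resolution refutation of
`sumEncoding 1 E` has at least `2^{r^ε}` lines — uniformly in `n` and `m` (Theorem C gave this
for `a < ℓ/2 - 1`). [Erdős–Lovász 1975; Ben-Sasson–Wigderson 2001, Thm. 6.5; Beame–Pitassi 1996;
Krajíček 2019, §13.4, Problem 19.4.5] [folklore] -/
theorem resolution_size_column_pow_lll (ℓ : ℕ) (hℓ : 1 ≤ ℓ) (a : ℝ) (ha : 0 ≤ a)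
    (hal : a < ((⌈(3 : ℝ) / 4 * ℓ⌉₊ - 1 : ℕ) : ℝ)) :
    ∃ ε : ℝ, 0 < ε ∧ ∃ R : ℝ, ∀ r : ℝ, R ≤ r → ∀ (n m : ℕ) (E : Fin m → LinEqMod 2 n),
      (∀ i, (E i).supp.card ≤ ℓ) →
      IsBoundaryExpander (fun i => (E i).supp.map Fin.valEmbedding) r (3 / 4 * ℓ) →
      (∀ j : Fin n, (((univ : Finset (Fin m)).filter fun i => j ∈ (E i).supp).card : ℝ) ≤ r ^ a) →
      ∀ π : List (ResLine ℕ), IsResRefutation (sumEncoding 1 E) π →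
        (2 : ℝ) ^ (r ^ ε) ≤ (π.length : ℝ) := by
  -- the exponent gap
  set Lr : ℝ := ((⌈(3 : ℝ) / 4 * ℓ⌉₊ - 1 : ℕ) : ℝ) with hLr
  have hLr0 : 0 < Lr := lt_of_le_of_lt ha hal
  set ε₀ : ℝ := (Lr - a) / (2 * Lr) with hε₀
  have hgap : 0 < Lr - a := by linarith
  have hε₀pos : 0 < ε₀ := by rw [hε₀]; positivity
  have hε₀lt : ε₀ < 1 := by
    rw [hε₀, div_lt_one (by positivity)]; linarith
  set δ : ℝ := (Lr - a) / 2 with hδ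
  have hδpos : 0 < δ := by rw [hδ]; positivity
  have hexpo : (1 - ε₀) * Lr = a + δ := by
    rw [hε₀, hδ]; field_simp; ring
  have hℓ' : (1 : ℝ) ≤ ℓ := by exact_mod_cast hℓ
  refine ⟨ε₀ / 2, by positivity, ?_⟩
  -- eventual conditions on `r`
  have hev1 : ∀ᶠ r : ℝ in atTop, ((ℓ : ℝ) + 1) * 2 ^ (ℓ + 4) ≤ r ^ δ :=
    (tendsto_rpow_atTop hδpos).eventually (eventually_ge_atTop _)
  have hev2 : ∀ᶠ r : ℝ in atTop, (115 : ℝ) ≤ r ^ (ε₀ / 2) :=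
    (tendsto_rpow_atTop (by positivity)).eventually (eventually_ge_atTop _)
  obtain ⟨R, hR⟩ := Filter.eventually_atTop.1 ((hev1.and hev2).and (eventually_ge_atTop (2 : ℝ)))
  refine ⟨R, fun r hr n m E hsparse hexp hcol π hπ => ?_⟩
  obtain ⟨⟨hr1, hr2⟩, hr4⟩ := hR r hr
  have hr0 : 0 < r := by linarith
  -- column weight `≤ r^a ≤ r^{(1-ε₀)Lr}/((ℓ+1) 2^{ℓ+4})`
  set Δ : ℕ := ⌊r ^ a⌋₊ with hΔdef
  have hcolΔ : ∀ j : Fin n, ((univ : Finset (Fin m)).filter fun i => j ∈ (E i).supp).card ≤ Δ := by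
    intro j
    rw [hΔdef]
    exact Nat.le_floor (hcol j)
  have hΔ : (Δ : ℝ) ≤ r ^ ((1 - ε₀) * Lr) / (((ℓ : ℝ) + 1) * 2 ^ (ℓ + 4)) := by
    rw [hexpo, le_div_iff₀ (by positivity), Real.rpow_add hr0]
    have h1 : (Δ : ℝ) ≤ r ^ a := Nat.floor_le (Real.rpow_nonneg hr0.le a)
    exact mul_le_mul h1 hr1 (by positivity) (Real.rpow_nonneg hr0.le a)
  have hmain := resolution_size_nfree_column_lll ℓ hℓ ε₀ hε₀pos hε₀lt r hr4 n m Δ E hsparse hexp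
    hcolΔ hΔ π hπ
  -- `r^{ε₀/2} ≤ r^{ε₀}/112 - 2`
  have hz : r ^ (ε₀ / 2) ≤ r ^ ε₀ / 112 - 2 := by
    set z : ℝ := r ^ (ε₀ / 2) with hz
    have hzz : r ^ ε₀ = z * z := by
      rw [hz, ← Real.rpow_add hr0]; congr 1; ring
    rw [hzz, le_sub_iff_add_le, le_div_iff₀ (by positivity)]
    have hz1 : (115 : ℝ) ≤ z := hr2
    nlinarith only [hz1]
  calc (2 : ℝ) ^ (r ^ (ε₀ / 2)) ≤ (2 : ℝ) ^ (r ^ ε₀ / 112 - 2) :=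
        Real.rpow_le_rpow_of_exponent_le (by norm_num) hz
    _ ≤ (π.length : ℝ) := hmain

end Summit.PneNP.PneNP.Theorems.ResNFree
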